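import Literature.NumberTheory.Li1992.RallisLocalFactorSplitUnramifiedOfGenerator
import Literature.NumberTheory.GelbartRogawski1991.FinLocalSplittingsSplitSpherical
import Literature.RepresentationTheory.HeisenbergGroup.SchrodingerConjugateTorusCoeffBound
import Literature.NumberTheory.Automorphic.SmoothRepresentationLocallyConstant
import HarnessLib

/-!
# [Li1992, Thm 2.1 (27) / §5] — the local integrals at a SPLIT place for GENERAL test vectors: decay of the matrix
# coefficients `⟨ω_v(z·1_N)Φ, Φ'⟩` along the split torus and their absolute integrability over `U(J₁)(F_v)`

J.-S. Li, J. reine angew. Math. **428** (1992), Thm 2.1 (27) p. 184 and §5 p. 206 (the local integrals of Rallis' inner product formula);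
A. Weil, Acta Math. 113 (1965), n° 51 (absolute convergence of the orbital sums in Weil's range); J. Tate, in Cassels–Fröhlich (1967),
Ch. XV §3.2 (`F_vˣ = ⊔_m ϖ^m 𝒪ˣ`).  Sequels in the tree compute these local integrals EXACTLY for the spherical vector at the UNRAMIFIED split
places (★ `RallisLocalFactorSplitUnramified(OfGenerator)`, ★ `FinLocalSplittingsSplitSphericalCoeff(Darboux)`); this file supplies what the
finitely many remaining split places need — for ARBITRARY `Φ, Φ' ∈ 𝒮(F_vᴺ)`:

* §0 `Li1992.integrable_of_norm_le_of_cosets` (kernel, any topological group): on `G = ⋃_m z₀^m K` (`K` an open subgroup of finite measure for a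
  left-invariant `μ`) a strongly measurable `f` with `‖f‖ ≤ b m` on `z₀^m K` and `Σ_m b m < ∞` is integrable (the dominated version of ★
  `integrable_and_hasSum_integral_of_cosets`, no right-`K`-invariance of `f` needed);
* §1 `valued_t_mul_of_generates`-type bookkeeping: with a coordinate `t : U(J₁)(F_v) → F_v`, `|t z|_v = |z_w|_w` (the shape of ★
  `forall_exists_unit_sphericalCoeff_of_darboux`), the norm `‖t(z₀^m k)‖ = ‖t z₀‖^m`-style valuation identities for `k ∈ U(J₁)(𝒪_v)`;
* §2 **`exists_norm_localCoeff_le_of_darboux`** — from split-place Darboux data `ι_v(z · 1_N) = γ⁻¹ m(t z · 1) γ` (ALL `z`) and an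
  `L²(μ'ᴺ)`-isometric `ω_v`: `∀ Φ Φ', ∃ C ≥ 0, ∀ z, ‖∫ (ω_v(z·1_N)Φ) conj Φ' dμ'ᴺ‖ ≤ C · min(√(‖t z‖_vᴺ), (√(‖t z‖_vᴺ))⁻¹)` — the split torus
  `U(J₁)(F_v) ≅ E_w^×` acts, up to a Darboux conjugation, by the normalised dilations of the Schrödinger model, whose coefficients decay
  like `q_v^{−N|v_w(z)|∕2}` (★ `HeisenbergGroup.exists_norm_integral_implementer_conjTorus_mul_conj_le'`);
* §3 **`integrable_localCoeff_of_darboux_of_generates`** — at such a place, for a generator `z₀` of `U(J₁)(F_v) ∕ U(J₁)(𝒪_v)` with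
  `|z₀,w| = q_w^{∓1}` and any left-invariant measure `dh` finite on compacts, `h ↦ ∫ (ω_v(h·1_N)Φ) conj Φ' dμ'ᴺ` is `dh`-INTEGRABLE
  (measurable because `ω_v` is smooth, ★ `isSmooth_omegaLoc`; dominated on the coset `z₀^m U(J₁)(𝒪_v)` by `C (√(q_vᴺ))^{-|m|}`, summable
  for `N ≥ 1`) — the local input at the finitely many «bad» split places of the absolute convergence of the orbital sums
  `Σ_γ ‖⟨ω(x₂ γ x₁⁻¹)Φ₁, Φ₂⟩‖` of the rank-one doubled pair (conjunct (ii) of `StubSW2`, E-2 child line of crux H413; road C of the cell bus).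

KERNEL only: theorems, no definition, no named fact, no `sorry`.  Cell hodgecm-mathlib, FLOOR 0, programme P4 ∕ E-2, row C-β, crux item H413
(`--supports stmt-HodgeConjecture-24833`).  HC_CM is proved only modulo the printed citations until rung 0 closes; nothing here is a claim about them.

## References
* [Li1992] J.-S. Li, J. reine angew. Math. 428 (1992) 177–217 — Thm 2.1 (27) p. 184; §5 p. 206.
* [Weil1965] A. Weil, Acta Math. 113 (1965) 1–87 — n° 51 (p. 72).
* [TateThesis1967] J. Tate, in Cassels–Fröhlich, *Algebraic Number Theory* (1967), Ch. XV §3.2.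
* [MoeglinVignerasWaldspurger1987] C. Mœglin, M.-F. Vignéras, J.-L. Waldspurger, LNM 1291 (1987), Chap. 2 II.1, II.6, III.1.
-/

set_option autoImplicit false

noncomputable section

open NumberField IsDedekindDomain MeasureTheory Filter Set
open scoped Matrix NNReal Topology ComplexConjugate
open Literature.RepresentationTheory Literature.RepresentationTheory.HeisenbergGroup
open Literature.NumberTheory.Automorphic
open Literature.NumberTheory.Automorphic.UnitaryGroup
open Literature.NumberTheory.Automorphic.Liu2021
open Literature.NumberTheory.GaloisRepresentations.IsNonarchimedeanLocalField

/-! ## §0 Dominated integration over `⋃_m z₀^m K` -/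

namespace Literature.NumberTheory.Li1992

section Cosets

variable {G : Type*} [Group G] [TopologicalSpace G] [IsTopologicalGroup G] [MeasurableSpace G] [BorelSpace G]

/-- **dominated integrability over the cosets `z₀^m K`**: if `K` is an open subgroup of finite measure for the left-invariant `μ`, every
`h ∈ G` lies in some `z₀^m K`, `f` is a.e.-strongly measurable and `‖f h‖ ≤ b m` whenever `h ∈ z₀^m K`, with `Σ_m b m < ∞`, then `f` is
`μ`-integrable (`∫_{z₀^m K} ‖f‖ ≤ μ(K) b m`).  The dominated form of the bookkeeping `∫_{F_vˣ} = Σ_m ∫_{ϖ^m 𝒪ˣ}` of [TateThesis1967, §3.2].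
[cite: TateThesis1967, §3.2] -/
theorem integrable_of_norm_le_of_cosets (μ : Measure G) [μ.IsMulLeftInvariant] (K : Subgroup G) (hKo : IsOpen (K : Set G))
    (hKμ : μ K ≠ ⊤) (z₀ : G) (hcover : ∀ h : G, ∃ m : ℤ, (z₀ ^ m)⁻¹ * h ∈ K)
    (f : G → ℂ) (hf : AEStronglyMeasurable f μ) (b : ℤ → ℝ)
    (hb : ∀ (m : ℤ) (h : G), (z₀ ^ m)⁻¹ * h ∈ K → ‖f h‖ ≤ b m) (hsum : Summable b) :
    Integrable f μ := by
  classical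
  set s : ℤ → Set G := fun m => (fun h : G => (z₀ ^ m)⁻¹ * h) ⁻¹' (K : Set G) with hs
  have hsm : ∀ m, MeasurableSet (s m) := fun m => (hKo.preimage (continuous_const_mul _)).measurableSet
  have hμs : ∀ m, μ (s m) = μ K := fun m => measure_preimage_mul μ _ _
  have hcov : (⋃ m, s m) = Set.univ := Set.eq_univ_of_forall fun h => Set.mem_iUnion.2 (hcover h)
  have hb0 : ∀ m, 0 ≤ b m := fun m => by
    obtain ⟨h, hh⟩ : ∃ h : G, (z₀ ^ m)⁻¹ * h ∈ K := ⟨z₀ ^ m, by rw [inv_mul_cancel]; exact K.one_mem⟩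
    exact (norm_nonneg _).trans (hb m h hh)
  -- integrability on each coset
  have hi : ∀ m, IntegrableOn f (s m) μ := fun m => by
    refine Integrable.mono' (integrableOn_const (C := (b m : ℝ)) (by rw [hμs]; exact hKμ)) hf.restrict ?_
    rw [ae_restrict_iff' (hsm m)]
    exact Eventually.of_forall fun h hh => hb m h hh
  have hnorm : ∀ m, ∫ h in s m, ‖f h‖ ∂μ ≤ μ.real K * b m := fun m => by
    calc ∫ h in s m, ‖f h‖ ∂μ ≤ ∫ h in s m, b m ∂μ := by
          refine setIntegral_mono_on (hi m).norm (integrableOn_const (by rw [hμs]; exact hKμ)) (hsm m) fun h hh => hb m h hh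
      _ = μ.real K * b m := by rw [setIntegral_const, smul_eq_mul, Measure.real, Measure.real, hμs]
  have hint : IntegrableOn f (⋃ m, s m) μ := by
    refine integrableOn_iUnion_of_summable_integral_norm hi ?_
    refine Summable.of_nonneg_of_le (fun m => integral_nonneg fun _ => norm_nonneg _) hnorm (hsum.mul_left _)
  rw [hcov] at hint
  exact integrableOn_univ.1 hint

end Cosets

/-- **`min(a^e, a^{-e}) = (a⁻¹)^{|e|}` for `a ≥ 1`** (the decay of a unitary dilation coefficient in either direction). [cite: Li1992, §5 p. 206] -/
theorem min_zpow_zpow_inv_eq {a : ℝ} (ha : 1 ≤ a) (e : ℤ) : min (a ^ e) (a ^ e)⁻¹ = (a⁻¹) ^ e.natAbs := by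
  rcases le_or_gt 0 e with he | he
  · obtain ⟨n, rfl⟩ := Int.eq_ofNat_of_zero_le he
    have h1 : (1 : ℝ) ≤ a ^ n := one_le_pow₀ ha
    rw [Int.natAbs_natCast, zpow_natCast, inv_pow, min_eq_right ((inv_le_one_of_one_le₀ h1).trans h1)]
  · obtain ⟨n, hn⟩ := Int.exists_eq_neg_ofNat he.le
    subst hn
    have h1 : (1 : ℝ) ≤ a ^ n := one_le_pow₀ ha
    rw [Int.natAbs_neg, Int.natAbs_natCast, zpow_neg, zpow_natCast, inv_inv, inv_pow,
      min_eq_left ((inv_le_one_of_one_le₀ h1).trans h1)]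

/-- `√(x^e)`-bookkeeping: for `Q > 0` and `e : ℤ`, `√(Q ^ e) = (√Q) ^ e`. [cite: Li1992, §5 p. 206] -/
theorem sqrt_zpow_eq {Q : ℝ} (hQ : 0 < Q) (e : ℤ) : Real.sqrt (Q ^ e) = (Real.sqrt Q) ^ e := by
  have hs : 0 < Real.sqrt Q := Real.sqrt_pos.2 hQ
  rw [Real.sqrt_eq_iff_mul_self_eq_of_pos (zpow_pos hs e), ← mul_zpow, Real.mul_self_sqrt hQ.le]

end Literature.NumberTheory.Li1992

/-! ## §1 Valuation bookkeeping on the split torus `U(J₁)(F_v)` -/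

namespace Literature.NumberTheory.GelbartRogawski1991.UnitaryDualPair.LocalSplitting.FinLocalSplittings

variable {F : Type} [Field F] [NumberField F] {E : Type} [Field E] [NumberField E] [Algebra F E]
  [Algebra.IsQuadraticExtension F E] {c : E ≃ₐ[F] E} {N : ℕ} {δ : E} {hcδ : c δ = -δ} {hδ : δ ≠ 0} {d : F}
  {hd : δ * δ = algebraMap F E d} {T : Matrix (Fin N) (Fin N) F} {hT : T.IsSymm}
  {J : Matrix (Fin N) (Fin N) E} {hJ : J = T.map (algebraMap F E)}
  (𝓢 : FinLocalSplittings F E c N hcδ hδ hd T hT hJ) (J₁ : Matrix (Fin 1) (Fin 1) E) (hJ₁ : J₁ 0 0 ≠ 0)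
  (hTd : IsUnit T.det) (v : HeightOneSpectrum (𝓞 F))

omit [Algebra.IsQuadraticExtension F E] in
/-- the `w`-entry of an element of `U(J₁)(F_v) ≤ Π_w GL₁(E_w)` is its `w`-determinant (a `1 × 1` matrix). [cite: PlatonovRapinchuk1994, §5.1] -/
theorem coe_det_apply_eq_entry (w : PlacesOver E v) (u : localPi E c 1 J₁ v) :
    ((Matrix.GeneralLinearGroup.det ((u : LocalGLPi E 1 v) w) : (w.1.adicCompletion E)ˣ) : w.1.adicCompletion E) =
      (((u : LocalGLPi E 1 v) w : GL (Fin 1) (w.1.adicCompletion E)) : Matrix (Fin 1) (Fin 1) (w.1.adicCompletion E)) 0 0 := by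
  rw [Matrix.GeneralLinearGroup.val_det_apply, Matrix.det_fin_one]

omit [Algebra.IsQuadraticExtension F E] in
/-- the `w`-entry is multiplicative on `U(J₁)(F_v)`: `(h k)_w = h_w k_w` (products of `1 × 1` matrices). [cite: PlatonovRapinchuk1994, §5.1] -/
theorem valued_entry_mul (w : PlacesOver E v) (h k : localPi E c 1 J₁ v) :
    Valued.v ((((h * k : localPi E c 1 J₁ v) : LocalGLPi E 1 v) w : Matrix (Fin 1) (Fin 1) (w.1.adicCompletion E)) 0 0) =
      Valued.v ((((h : localPi E c 1 J₁ v) : LocalGLPi E 1 v) w : Matrix (Fin 1) (Fin 1) (w.1.adicCompletion E)) 0 0) *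
        Valued.v ((((k : localPi E c 1 J₁ v) : LocalGLPi E 1 v) w : Matrix (Fin 1) (Fin 1) (w.1.adicCompletion E)) 0 0) := by
  rw [← coe_det_apply_eq_entry J₁ v w, ← coe_det_apply_eq_entry J₁ v w, ← coe_det_apply_eq_entry J₁ v w, Subgroup.coe_mul,
    Pi.mul_apply, map_mul, Units.val_mul, map_mul]

omit [Algebra.IsQuadraticExtension F E] in
/-- the `w`-entry of `z₀^m` has valuation `v(z₀,w)^m`. [cite: PlatonovRapinchuk1994, §5.1] -/
theorem valued_entry_zpow (w : PlacesOver E v) (z₀ : localPi E c 1 J₁ v) (m : ℤ) :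
    Valued.v ((((z₀ ^ m : localPi E c 1 J₁ v) : LocalGLPi E 1 v) w : Matrix (Fin 1) (Fin 1) (w.1.adicCompletion E)) 0 0) =
      Valued.v ((((z₀ : localPi E c 1 J₁ v) : LocalGLPi E 1 v) w : Matrix (Fin 1) (Fin 1) (w.1.adicCompletion E)) 0 0) ^ m := by
  rw [← coe_det_apply_eq_entry J₁ v w, ← coe_det_apply_eq_entry J₁ v w, Subgroup.coe_zpow, Pi.pow_apply, map_zpow,
    Units.val_zpow_eq_zpow_val, map_zpow₀]

omit [Algebra.IsQuadraticExtension F E] in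
/-- the `w`-entry of an element of `U(J₁)(𝒪_v)` has valuation `1` (★ `valued_det_eq_one_iff_mem_glInt_one`). [cite: PlatonovRapinchuk1994, §5.1] -/
theorem valued_entry_eq_one_of_mem_localInt (w : PlacesOver E v) {k : localPi E c 1 J₁ v} (hk : k ∈ localInt E c 1 J₁ v) :
    Valued.v ((((k : localPi E c 1 J₁ v) : LocalGLPi E 1 v) w : Matrix (Fin 1) (Fin 1) (w.1.adicCompletion E)) 0 0) = 1 := by
  rw [← coe_det_apply_eq_entry J₁ v w]
  exact (valued_det_eq_one_iff_mem_glInt_one _).2 ((mem_localInt_iff E c 1 J₁ v k).1 hk w)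

omit [Algebra.IsQuadraticExtension F E] in
/-- **the coordinate on the coset `z₀^m K`**: if `|t z|_v = |z_w|` for all `z`, `v(z₀,w) = exp ε` and the `w`-entry of `(z₀^m)⁻¹ h` has
valuation `1`, then `v(t h) = exp (ε m)`. [cite: TateThesis1967, §3.2] -/
theorem valued_t_of_valued_entry_eq_one (w : PlacesOver E v) (t : localPi E c 1 J₁ v → v.adicCompletion F)
    (ht : ∀ z : localPi E c 1 J₁ v, Valued.v (t z) =
      Valued.v ((((z : localPi E c 1 J₁ v) : LocalGLPi E 1 v) w : Matrix (Fin 1) (Fin 1) (w.1.adicCompletion E)) 0 0))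
    (z₀ : localPi E c 1 J₁ v) {ε : ℤ}
    (hz₀ : Valued.v ((((z₀ : localPi E c 1 J₁ v) : LocalGLPi E 1 v) w : Matrix (Fin 1) (Fin 1) (w.1.adicCompletion E)) 0 0) =
      WithZero.exp ε)
    {m : ℤ} {h : localPi E c 1 J₁ v}
    (hh : Valued.v (((((z₀ ^ m)⁻¹ * h : localPi E c 1 J₁ v) : LocalGLPi E 1 v) w : Matrix (Fin 1) (Fin 1) (w.1.adicCompletion E)) 0 0) = 1) :
    Valued.v (t h) = WithZero.exp (ε * m) := by
  have e1 : h = z₀ ^ m * ((z₀ ^ m)⁻¹ * h) := by rw [mul_inv_cancel_left]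
  rw [ht h, e1, valued_entry_mul J₁ v w, valued_entry_zpow J₁ v w, hh, mul_one, hz₀, ← WithZero.exp_zsmul, smul_eq_mul, mul_comm]

omit [Algebra.IsQuadraticExtension F E] in
/-- **the coordinate on the coset `z₀^m U(J₁)(𝒪_v)`**: if `|t z|_v = |z_w|` for all `z`, `v(z₀,w) = exp ε` and `(z₀^m)⁻¹ h ∈ U(J₁)(𝒪_v)`, then
`v(t h) = exp (ε m)`. [cite: TateThesis1967, §3.2] -/
theorem valued_t_of_mem_coset (w : PlacesOver E v) (t : localPi E c 1 J₁ v → v.adicCompletion F)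
    (ht : ∀ z : localPi E c 1 J₁ v, Valued.v (t z) =
      Valued.v ((((z : localPi E c 1 J₁ v) : LocalGLPi E 1 v) w : Matrix (Fin 1) (Fin 1) (w.1.adicCompletion E)) 0 0))
    (z₀ : localPi E c 1 J₁ v) {ε : ℤ}
    (hz₀ : Valued.v ((((z₀ : localPi E c 1 J₁ v) : LocalGLPi E 1 v) w : Matrix (Fin 1) (Fin 1) (w.1.adicCompletion E)) 0 0) =
      WithZero.exp ε)
    {m : ℤ} {h : localPi E c 1 J₁ v} (hh : (z₀ ^ m)⁻¹ * h ∈ localInt E c 1 J₁ v) :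
    Valued.v (t h) = WithZero.exp (ε * m) :=
  valued_t_of_valued_entry_eq_one J₁ v w t ht z₀ hz₀ (valued_entry_eq_one_of_mem_localInt J₁ v w hh)

/-! ## §2 The decay of `⟨ω_v(z · 1_N)Φ, Φ'⟩` along the split torus, from Darboux data -/

include hTd in
/-- **DECAY OF THE LOCAL MATRIX COEFFICIENTS ALONG THE SPLIT TORUS, GENERAL TEST VECTORS.**  At a place `v` with split-place Darboux data —
`γ ∈ Sp(𝕎_v)` and a coordinate `t : U(J₁)(F_v) → F_v^×` with `ι_v(z · 1_N) = γ⁻¹ m(t z · 1) γ` for ALL `z` (★ `LocalUnitarySplitPlaceDarboux`,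
the binders of ★ `forall_exists_unit_sphericalCoeff_of_darboux`) — and `ω_v` `L²(μ'ᴺ)`-isometric: for all `Φ, Φ' ∈ 𝒮(F_vᴺ)` there is
`C ≥ 0` with `‖∫ (ω_v(z · 1_N)Φ) conj Φ' dμ'ᴺ‖ ≤ C · min(√(‖t z‖_vᴺ), (√(‖t z‖_vᴺ))⁻¹)` for every `z ∈ U(J₁)(F_v)`.
[cite: Li1992, §5 p. 206] [cite: MoeglinVignerasWaldspurger1987, Chap. 2 II.1 (A), II.6] -/
theorem exists_norm_localCoeff_le_of_darboux
    (γ : LocalSp F N T v) (t : localPi E c 1 J₁ v → v.adicCompletion F) (ht0 : ∀ z, t z ≠ 0)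
    (hcenter : ∀ (z : localPi E c 1 J₁ v) (a₀ : GL (Fin N) (v.adicCompletion F)),
      (a₀ : Matrix (Fin N) (Fin N) (v.adicCompletion F)) = t z • 1 →
      iota F E c N hcδ hδ hd T hT hJ v (localCenter E c N J J₁ hJ₁ v z) =
        γ⁻¹ * SymplecticMatrix.transportSp (localGram F N T v) (isUnit_det_localGram F N T hTd v)
          (SymplecticMatrix.levi a₀) * γ)
    [MeasurableSpace (v.adicCompletion F)] [BorelSpace (v.adicCompletion F)] (μ' : Measure (v.adicCompletion F))
    [μ'.IsAddHaarMeasure] (hL2 : (𝓢.omegaLoc v).IsL2Isometric (Measure.pi fun _ : Fin N => μ'))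
    (Φ Φ' : SchwartzBruhat (Fin N → v.adicCompletion F)) :
    ∃ C : ℝ, 0 ≤ C ∧ ∀ z : localPi E c 1 J₁ v,
      ‖∫ x, ((𝓢.omegaLoc v (localCenter E c N J J₁ hJ₁ v z) Φ : SchwartzBruhat (Fin N → v.adicCompletion F)) :
              (Fin N → v.adicCompletion F) → ℂ) x *
            conj (((Φ' : SchwartzBruhat (Fin N → v.adicCompletion F)) : (Fin N → v.adicCompletion F) → ℂ) x)
            ∂(Measure.pi fun _ : Fin N => μ')‖ ≤
        C * min (Real.sqrt (((normAbs (v.adicCompletion F) (t z) : ℝ≥0) : ℝ) ^ Fintype.card (Fin N)))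
              (Real.sqrt (((normAbs (v.adicCompletion F) (t z) : ℝ≥0) : ℝ) ^ Fintype.card (Fin N)))⁻¹ := by
  have hbT : ∀ y : Fin N → v.adicCompletion F, Continuous fun u : Fin N → v.adicCompletion F =>
      localPairing F N T v u y := fun y => by
    simp only [Matrix.toLinearMap₂'_apply', dotProduct]
    exact continuous_finsetSum _ fun i _ => (continuous_apply i).mul continuous_const
  -- the operator components `φ z = (s_v (z · 1_N)).2`
  let φ : localPi E c 1 J₁ v →* (SchwartzBruhat (Fin N → v.adicCompletion F) ≃ₗ[ℂ] SchwartzBruhat (Fin N → v.adicCompletion F)) :=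
    (MonoidHom.snd _ _).comp (((MpPsi (localSchrodinger F N T v)).subtype).comp ((𝓢.s v).comp (localCenter E c N J J₁ hJ₁ v)))
  have hφ : ∀ z : localPi E c 1 J₁ v, φ z = ((𝓢.s v (localCenter E c N J J₁ hJ₁ v z) : LocalMp F N T v) : LocalSp F N T v ×
      (SchwartzBruhat (Fin N → v.adicCompletion F) ≃ₗ[ℂ] SchwartzBruhat (Fin N → v.adicCompletion F))).2 := fun _ => rfl
  have hφiso : ∀ (z : localPi E c 1 J₁ v) (Θ : SchwartzBruhat (Fin N → v.adicCompletion F)),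
      SchwartzBruhat.l2NormSq (Measure.pi fun _ : Fin N => μ') (φ z Θ) = SchwartzBruhat.l2NormSq (Measure.pi fun _ : Fin N => μ') Θ :=
    fun z Θ => by rw [hφ, ← 𝓢.omegaLoc_eq_snd_apply v]; exact hL2.l2NormSq_apply _ Θ
  -- the Heisenberg-level bound
  obtain ⟨C, hC0, hC⟩ := exists_norm_integral_implementer_conjTorus_mul_conj_le' (localGram F N T v)
    (isUnit_det_localGram F N T hTd v) (isLocallyConstant_of_isContinuousNontrivial (isContinuousNontrivial_adeleAddCharAt F v)) hbT
    μ' (isContinuousNontrivial_adeleAddCharAt F v) γ Φ Φ'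
  refine ⟨C, hC0, fun z => ?_⟩
  -- the scalar `a₀ = t z · 1`
  let a₀ : GL (Fin N) (v.adicCompletion F) :=
    Units.map (algebraMap (v.adicCompletion F) (Matrix (Fin N) (Fin N) (v.adicCompletion F))).toMonoidHom
      (Units.mk0 (t z) (ht0 z))
  have ha₀ : (a₀ : Matrix (Fin N) (Fin N) (v.adicCompletion F)) = t z • 1 := by
    change algebraMap (v.adicCompletion F) (Matrix (Fin N) (Fin N) (v.adicCompletion F)) (t z) = _
    exact Algebra.algebraMap_eq_smul_one (t z)
  have hM : Implements (localSchrodinger F N T v) (ofSymplectic _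
      (γ⁻¹ * SymplecticMatrix.transportSp (localGram F N T v) (isUnit_det_localGram F N T hTd v)
        (SymplecticMatrix.levi a₀) * γ)) (φ z) := by
    rw [hφ, ← hcenter z a₀ ha₀]; exact 𝓢.implements_snd_s v _
  have key := hC (ht0 z) ha₀ hM (hφiso z)
  have hω : 𝓢.omegaLoc v (localCenter E c N J J₁ hJ₁ v z) Φ = φ z Φ := by rw [𝓢.omegaLoc_eq_snd_apply v, ← hφ]
  rw [hω]
  exact key

/-! ## §3 Integrability over `U(J₁)(F_v)` -/

include hTd in
/-- **ABSOLUTE INTEGRABILITY OF THE LOCAL MATRIX COEFFICIENTS, COSET FORM.**  At a place `v` with split-place Darboux data at `w ∣ v` (`γ`, `t` with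
`|t z|_v = |z_w|_w` and `ι_v(z · 1_N) = γ⁻¹ m(t z · 1) γ` for all `z`) and `ω_v` `L²(μ'ᴺ)`-isometric, let `K ≤ U(J₁)(F_v)` be an open subgroup on
which the `w`-entry has valuation `1`, of finite measure for the left-invariant `dh`, and `z₀` an element with `v(z₀,w) = exp ε`, `ε ≠ 0`, such
that `U(J₁)(F_v) = ⋃_m z₀^m K`; let `N ≥ 1`.  Then for all `Φ, Φ' ∈ 𝒮(F_vᴺ)` the matrix coefficient `h ↦ ∫ (ω_v(h · 1_N)Φ) conj Φ' dμ'ᴺ` is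
`dh`-integrable (measurable because `ω_v` is smooth; dominated on `z₀^m K` by `C (√(q_vᴺ))^{-|ε m|}`).
[cite: Li1992, Thm 2.1 (27) p. 184; §5 p. 206] [cite: TateThesis1967, §3.2] -/
theorem integrable_localCoeff_of_darboux_of_cosets [NeZero N] (w : PlacesOver E v)
    (γ : LocalSp F N T v) (t : localPi E c 1 J₁ v → v.adicCompletion F)
    (ht : ∀ z : localPi E c 1 J₁ v, Valued.v (t z) =
      Valued.v ((((z : localPi E c 1 J₁ v) : LocalGLPi E 1 v) w : Matrix (Fin 1) (Fin 1) (w.1.adicCompletion E)) 0 0))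
    (hcenter : ∀ (z : localPi E c 1 J₁ v) (a₀ : GL (Fin N) (v.adicCompletion F)),
      (a₀ : Matrix (Fin N) (Fin N) (v.adicCompletion F)) = t z • 1 →
      iota F E c N hcδ hδ hd T hT hJ v (localCenter E c N J J₁ hJ₁ v z) =
        γ⁻¹ * SymplecticMatrix.transportSp (localGram F N T v) (isUnit_det_localGram F N T hTd v)
          (SymplecticMatrix.levi a₀) * γ)
    [MeasurableSpace (v.adicCompletion F)] [BorelSpace (v.adicCompletion F)] (μ' : Measure (v.adicCompletion F))
    [μ'.IsAddHaarMeasure] (hL2 : (𝓢.omegaLoc v).IsL2Isometric (Measure.pi fun _ : Fin N => μ'))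
    (K : Subgroup (localPi E c 1 J₁ v)) (hKo : IsOpen (K : Set (localPi E c 1 J₁ v)))
    (hK1 : ∀ k ∈ K, Valued.v ((((k : localPi E c 1 J₁ v) : LocalGLPi E 1 v) w : Matrix (Fin 1) (Fin 1) (w.1.adicCompletion E)) 0 0) = 1)
    (z₀ : localPi E c 1 J₁ v) {ε : ℤ} (hε : ε ≠ 0)
    (hz₀ : Valued.v ((((z₀ : localPi E c 1 J₁ v) : LocalGLPi E 1 v) w : Matrix (Fin 1) (Fin 1) (w.1.adicCompletion E)) 0 0) =
      WithZero.exp ε)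
    (hcover : ∀ h : localPi E c 1 J₁ v, ∃ m : ℤ, (z₀ ^ m)⁻¹ * h ∈ K)
    [MeasurableSpace (localPi E c 1 J₁ v)] [BorelSpace (localPi E c 1 J₁ v)] (dh : Measure (localPi E c 1 J₁ v))
    [dh.IsMulLeftInvariant] (hKμ : dh K ≠ ⊤)
    (Φ Φ' : SchwartzBruhat (Fin N → v.adicCompletion F)) :
    Integrable (fun h : localPi E c 1 J₁ v =>
      ∫ x, ((𝓢.omegaLoc v (localCenter E c N J J₁ hJ₁ v h) Φ : SchwartzBruhat (Fin N → v.adicCompletion F)) :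
            (Fin N → v.adicCompletion F) → ℂ) x *
          conj (((Φ' : SchwartzBruhat (Fin N → v.adicCompletion F)) : (Fin N → v.adicCompletion F) → ℂ) x)
          ∂(Measure.pi fun _ : Fin N => μ')) dh := by
  -- `t z ≠ 0`: the `w`-entry of `z` is a unit
  have ht0 : ∀ z : localPi E c 1 J₁ v, t z ≠ 0 := fun z h0 => by
    have h1 := ht z
    rw [h0, map_zero, ← coe_det_apply_eq_entry J₁ v w] at h1
    exact (Valuation.ne_zero_iff _).2 (Units.ne_zero _) h1.symm
  obtain ⟨C, hC0, hC⟩ := 𝓢.exists_norm_localCoeff_le_of_darboux J₁ hJ₁ hTd v γ t ht0 hcenter μ' hL2 Φ Φ'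
  -- the ratio `a = √(q_vᴺ) > 1`
  set q : ℝ := (residueFieldCard (v.adicCompletion F) : ℝ) with hq
  have hq1 : 1 < q := Nat.one_lt_cast.2 (one_lt_residueFieldCard _)
  have hq0 : 0 < q := lt_trans one_pos hq1
  set a : ℝ := Real.sqrt (q ^ Fintype.card (Fin N)) with ha
  have hQ1 : 1 < q ^ Fintype.card (Fin N) := by
    rw [Fintype.card_fin]; exact one_lt_pow₀ hq1 (NeZero.ne N)
  have ha1 : 1 < a := by rw [ha, Real.lt_sqrt zero_le_one, one_pow]; exact hQ1
  have hai0 : 0 ≤ a⁻¹ := inv_nonneg.2 (le_of_lt (lt_trans one_pos ha1))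
  have hai1 : a⁻¹ < 1 := inv_lt_one_of_one_lt₀ ha1
  -- measurability: the coefficient is locally constant (`ω_v` is smooth)
  have hmeas : AEStronglyMeasurable (fun h : localPi E c 1 J₁ v =>
      ∫ x, ((𝓢.omegaLoc v (localCenter E c N J J₁ hJ₁ v h) Φ : SchwartzBruhat (Fin N → v.adicCompletion F)) :
            (Fin N → v.adicCompletion F) → ℂ) x *
          conj (((Φ' : SchwartzBruhat (Fin N → v.adicCompletion F)) : (Fin N → v.adicCompletion F) → ℂ) x)
          ∂(Measure.pi fun _ : Fin N => μ')) dh := by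
    have hlc : IsLocallyConstant fun h : localPi E c 1 J₁ v => 𝓢.omegaLoc v (localCenter E c N J J₁ hJ₁ v h) Φ :=
      (Representation.IsSmooth.isLocallyConstant_apply (𝓢.omegaLoc v) (𝓢.isSmooth_omegaLoc v) Φ).comp_continuous
        (continuous_localCenter E c N J J₁ hJ₁ v)
    exact (hlc.comp fun Θ : SchwartzBruhat (Fin N → v.adicCompletion F) =>
      ∫ x, ((Θ : SchwartzBruhat (Fin N → v.adicCompletion F)) : (Fin N → v.adicCompletion F) → ℂ) x *
        conj (((Φ' : SchwartzBruhat (Fin N → v.adicCompletion F)) : (Fin N → v.adicCompletion F) → ℂ) x)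
        ∂(Measure.pi fun _ : Fin N => μ')).continuous.aestronglyMeasurable
  -- on the coset `z₀^m K`: `‖t h‖ = q^{-εm}`, so `min(√‖t h‖ᴺ, …⁻¹) = a^{-|ε m|} = ((a⁻¹)^{|ε|})^{|m|}`
  have hcoset : ∀ (m : ℤ) (h : localPi E c 1 J₁ v), (z₀ ^ m)⁻¹ * h ∈ K →
      min (Real.sqrt (((normAbs (v.adicCompletion F) (t h) : ℝ≥0) : ℝ) ^ Fintype.card (Fin N)))
          (Real.sqrt (((normAbs (v.adicCompletion F) (t h) : ℝ≥0) : ℝ) ^ Fintype.card (Fin N)))⁻¹ =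
        ((a⁻¹) ^ ε.natAbs) ^ m.natAbs := by
    intro m h hh
    have hvt : Valued.v (t h) = WithZero.exp (ε * m) := valued_t_of_valued_entry_eq_one J₁ v w t ht z₀ hz₀ (hK1 _ hh)
    have hnorm : ((normAbs (v.adicCompletion F) (t h) : ℝ≥0) : ℝ) = q ^ (ε * m) := by
      rw [normAbs_eq_inv_zpow_of_valued_eq v hvt, NNReal.coe_zpow, NNReal.coe_inv, NNReal.coe_natCast, inv_zpow', neg_neg]
    rw [hnorm, ← zpow_natCast, ← zpow_mul, mul_comm (ε * m), zpow_mul, zpow_natCast,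
      Li1992.sqrt_zpow_eq (pow_pos hq0 _), ← ha, Li1992.min_zpow_zpow_inv_eq ha1.le, Int.natAbs_mul, pow_mul]
  refine Li1992.integrable_of_norm_le_of_cosets dh K hKo hKμ z₀ hcover _ hmeas
    (fun m => C * ((a⁻¹) ^ ε.natAbs) ^ m.natAbs) (fun m h hh => ?_) ?_
  · rw [← hcoset m h hh]; exact hC h
  · exact (Li1992.summable_pow_natAbs (pow_nonneg hai0 _)
      (pow_lt_one₀ hai0 hai1 (Int.natAbs_ne_zero.2 hε))).mul_left C

include hTd in
/-- **ABSOLUTE INTEGRABILITY OF THE LOCAL MATRIX COEFFICIENTS AT A SPLIT PLACE, GENERAL TEST VECTORS, GENERATOR FORM.**  At a place `v` with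
split-place Darboux data at `w ∣ v`, `ω_v` `L²(μ'ᴺ)`-isometric, a generator `z₀` of `U(J₁)(F_v) ∕ U(J₁)(𝒪_v)` with `|z₀,w| = q_w^{∓1}` (★
`exists_generator_localPi_one_of_split`, ★ `valued_entry_eq_exp_or_of_generates`) and `N ≥ 1`: for every left-invariant measure `dh` on
`U(J₁)(F_v)` finite on compacts and all `Φ, Φ' ∈ 𝒮(F_vᴺ)`, the matrix coefficient `h ↦ ∫ (ω_v(h · 1_N)Φ) conj Φ' dμ'ᴺ` is `dh`-integrable.
[Li1992, §5 p. 206]: the split local integrals converge absolutely (decay `q_v^{−N|v_w(h)|∕2}` against the counting measure on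
`ℤ = U(J₁)(F_v)∕U(J₁)(𝒪_v)`). [cite: Li1992, Thm 2.1 (27) p. 184; §5 p. 206] [cite: TateThesis1967, §3.2] -/
theorem integrable_localCoeff_of_darboux_of_generates [NeZero N] (w : PlacesOver E v)
    (γ : LocalSp F N T v) (t : localPi E c 1 J₁ v → v.adicCompletion F)
    (ht : ∀ z : localPi E c 1 J₁ v, Valued.v (t z) =
      Valued.v ((((z : localPi E c 1 J₁ v) : LocalGLPi E 1 v) w : Matrix (Fin 1) (Fin 1) (w.1.adicCompletion E)) 0 0))
    (hcenter : ∀ (z : localPi E c 1 J₁ v) (a₀ : GL (Fin N) (v.adicCompletion F)),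
      (a₀ : Matrix (Fin N) (Fin N) (v.adicCompletion F)) = t z • 1 →
      iota F E c N hcδ hδ hd T hT hJ v (localCenter E c N J J₁ hJ₁ v z) =
        γ⁻¹ * SymplecticMatrix.transportSp (localGram F N T v) (isUnit_det_localGram F N T hTd v)
          (SymplecticMatrix.levi a₀) * γ)
    [MeasurableSpace (v.adicCompletion F)] [BorelSpace (v.adicCompletion F)] (μ' : Measure (v.adicCompletion F))
    [μ'.IsAddHaarMeasure] (hL2 : (𝓢.omegaLoc v).IsL2Isometric (Measure.pi fun _ : Fin N => μ'))
    (z₀ : localPi E c 1 J₁ v)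
    (hz₀ : ∀ h : localPi E c 1 J₁ v, ∃ (k₀ : localPi E c 1 J₁ v) (m : ℤ), k₀ ∈ localInt E c 1 J₁ v ∧ h = k₀ * z₀ ^ m)
    (hval : Valued.v ((((z₀ : LocalGLPi E 1 v) w : GL (Fin 1) (w.1.adicCompletion E)) :
        Matrix (Fin 1) (Fin 1) (w.1.adicCompletion E)) 0 0) = WithZero.exp (-1 : ℤ) ∨
      Valued.v ((((z₀ : LocalGLPi E 1 v) w : GL (Fin 1) (w.1.adicCompletion E)) :
        Matrix (Fin 1) (Fin 1) (w.1.adicCompletion E)) 0 0) = WithZero.exp (1 : ℤ))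
    [MeasurableSpace (localPi E c 1 J₁ v)] [BorelSpace (localPi E c 1 J₁ v)] (dh : Measure (localPi E c 1 J₁ v))
    [dh.IsMulLeftInvariant] [IsFiniteMeasureOnCompacts dh]
    (Φ Φ' : SchwartzBruhat (Fin N → v.adicCompletion F)) :
    Integrable (fun h : localPi E c 1 J₁ v =>
      ∫ x, ((𝓢.omegaLoc v (localCenter E c N J J₁ hJ₁ v h) Φ : SchwartzBruhat (Fin N → v.adicCompletion F)) :
            (Fin N → v.adicCompletion F) → ℂ) x *
          conj (((Φ' : SchwartzBruhat (Fin N → v.adicCompletion F)) : (Fin N → v.adicCompletion F) → ℂ) x)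
          ∂(Measure.pi fun _ : Fin N => μ')) dh := by
  rcases hval with hε | hε
  · exact 𝓢.integrable_localCoeff_of_darboux_of_cosets J₁ hJ₁ hTd v w γ t ht hcenter μ' hL2 (localInt E c 1 J₁ v)
      (isOpen_localInt E c 1 J₁ v) (fun k hk => valued_entry_eq_one_of_mem_localInt J₁ v w hk) z₀ (by norm_num) hε
      (exists_zpow_inv_mul_mem_of_generates J₁ v z₀ hz₀) dh (isCompact_localInt E c 1 J₁ v).measure_lt_top.ne Φ Φ'
  · exact 𝓢.integrable_localCoeff_of_darboux_of_cosets J₁ hJ₁ hTd v w γ t ht hcenter μ' hL2 (localInt E c 1 J₁ v)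
      (isOpen_localInt E c 1 J₁ v) (fun k hk => valued_entry_eq_one_of_mem_localInt J₁ v w hk) z₀ one_ne_zero hε
      (exists_zpow_inv_mul_mem_of_generates J₁ v z₀ hz₀) dh (isCompact_localInt E c 1 J₁ v).measure_lt_top.ne Φ Φ'

end Literature.NumberTheory.GelbartRogawski1991.UnitaryDualPair.LocalSplitting.FinLocalSplittings

end
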